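import Literature.AlgebraicGeometry.HodgeTheory.NodalPencilFibreBridge
import Literature.AlgebraicGeometry.HodgeTheory.PicardLefschetzOfPencilIsotopy
import Mathlib.Topology.Homotopy.Basic
import HarnessLib

/-!
# From the geometric monodromy of a monomial pencil on the regular locus to one-nodal Picard–Lefschetz data
# (the projective isotopy and the transfer of the localisation datum to the zero set)

Family `hodge`, layer `Literature/AlgebraicGeometry/HodgeTheory`. Written by the prover seat `hodge-nonav-prover-Bx` (g15, cell
`hodge-nonav`) as a brick of the ODP-ISOTOPY port (memo `PROGRAMME-ODP-ISOTOPY-Bx-g13` §2; Picard–Lefschetz binder hPL₁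
`picardLefschetz_oneNode` of crux K1-B, stmt-HodgeConjecture-19716). It feeds the socket
`PicardLefschetzOfPencilIsotopy.exists_isPicardLefschetzData_one_of_pencilIsotopy` with the output of the port: the geometric
monodromy `h, k : ℝ × S → S` of a pencil `b₀ + c·e_{xᵢ^d}` on the pencil slice `S ⊆ 𝒴°(ℂ)` (`NodalPencilMonodromyMap`: `h` continuous on
`ℝ × {c ≠ 0}`, `h(0, ·) = id`, `c(h(u, x)) = e^{2πiu} c(x)`, `k(u, ·)` the two-sided inverse with `c(k(u, x)) = e^{−2πiu} c(x)`) and a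
localisation datum on the member `X_c` (`NodalPencilLocalisation`: open cover `A ∪ B`, a continuous `κ` reading `k(1, ·)`, equal to
the identity on `B`, its restriction `κA` to `A`, a chart `e : A → {Σ zⱼ² = 1}` injective on `H_n(·; ℚ)`, the antipodal map `g` and
a homotopy `e ∘ κA ≃ g ∘ e`), for a loop `γ` of `U(ℂ)` at a point `s` with `b(s) = b₀ + c·e`, `b(γ u) = b₀ + e^{2πiu}c·e`:

* the PROJECTIVE ISOTOPY `h_u, k_u : ℙ(ℂⁿ⁺²) → ℙ(ℂⁿ⁺²)`, `h_u [z] = [z](h(u, σ_s [z]))` on `Z_s` (`σ_s` the section of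
  `NodalPencilFibreBridge`), with the six hypotheses of `UniversalHypersurfaceTransportOfIsotopy` (continuity on `I × Z_s`, `h_0 = id`,
  `h_u Z_s ⊆ Z_{γ u}`, `k_u Z_{γ u} ⊆ Z_s`, two-sided inverses);
* the localisation datum transferred along `Z_s ≃ₜ X_c`; the even-`n` non-triviality `∃ v, κ^* v ≠ v` from the rider "the rational
  transport along `γ` is not the identity" (the transport IS `κ^*` read on `Y_s`, by `exists_homeomorph_isRatTransport_of_isotopy`);
* **`exists_isPicardLefschetzData_one_of_pencilMonodromy`** — conclusion `∃ δ c, IsPicardLefschetzData n d 1 … γ ![δ] c`.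

Everything is proved; no definitions, no named facts. Honest scope: plumbing of the classical construction of the geometric monodromy of a
pencil near an ordinary double point; nothing here says HC or any rung is proved.

## References

* [VoisinHodgeII2003] C. Voisin, Hodge Theory and Complex Algebraic Geometry II (2003), §3.2.1 Thm. 3.16, Cor. 3.17; §2.3.1–2.3.3;
  §6.2.1.
* [VoisinHodgeI2002] C. Voisin, Hodge Theory and Complex Algebraic Geometry I (2002), §9.2.1 Prop. 9.5.
* [ArnoldGuseinzadeVarchenko2012] V. I. Arnold, S. M. Gusein-Zade, A. N. Varchenko, Singularities of Differentiable Maps II (2012),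
  Part I §1.1–§1.3, §2.1.
-/

noncomputable section

open CategoryTheory AlgebraicGeometry ContinuousMap TopologicalSpace Set Complex
open _root_.Topology
open scoped unitInterval LinearAlgebra.Projectivization Real
open Literature.AlgebraicTopology.SingularHomology Literature.Geometry.ComplexAnalytic
open Literature.AlgebraicGeometry.Motives Literature.AlgebraicGeometry.Motives.UniversalHypersurface
open Literature.AlgebraicGeometry.HodgeTheory.UniversalHypersurface Literature.NumberTheory.Transcendental

namespace Literature.AlgebraicGeometry.HodgeTheory

namespace NodalPencil

/-- **One-nodal Picard–Lefschetz data from the geometric monodromy of a monomial pencil and its localisation datum.** See the module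
docstring for the data. [cite: VoisinHodgeII2003, §3.2.1 Thm. 3.16 and Cor. 3.17] [cite: VoisinHodgeI2002, §9.2.1 Prop. 9.5]
[cite: ArnoldGuseinzadeVarchenko2012, Part I §1.3 and §2.1] -/
theorem exists_isPicardLefschetzData_one_of_pencilMonodromy {n d : ℕ} {i : Fin (n + 2)} (hn : 1 ≤ n) (hd : 1 ≤ d)
    (b₀ : DegIndex n d → ℂ) (hU : IsCohomologicallyLocallyTrivialOn (family ℂ n d) Set.univ)
    -- the geometric monodromy on the slice
    {δ₀ : ℝ} (h k : ℝ × pencilSlice n d i b₀ → pencilSlice n d i b₀)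
    (hhc : Continuous fun ux : ℝ × {x : pencilSlice n d i b₀ // pencilCoord n d i b₀ x.1 ≠ 0} => h (ux.1, ux.2.1))
    (hh0 : ∀ x, pencilCoord n d i b₀ x.1 ≠ 0 → h (0, x) = x)
    (hhk : ∀ u x, pencilCoord n d i b₀ x.1 ≠ 0 → ‖pencilCoord n d i b₀ x.1‖ < δ₀ →
      pencilCoord n d i b₀ (h (u, x)).1 = Complex.exp (((2 * π * u : ℝ) : ℂ) * Complex.I) * pencilCoord n d i b₀ x.1 ∧
      k (u, h (u, x)) = x ∧ h (u, k (u, x)) = x ∧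
      pencilCoord n d i b₀ (k (u, x)).1 = Complex.exp (((-(2 * π * u) : ℝ) : ℂ) * Complex.I) * pencilCoord n d i b₀ x.1)
    -- the member and the loop
    {c : ℂ} (hc0 : c ≠ 0) (hcδ : ‖c‖ < δ₀)
    {s : ComplexPoints (base ℂ n d)} (hs : coeffVector ℂ n d s = b₀ + Pi.single (regPowIndex n d i) c) (γ : Path s s)
    (hγ : ∀ u : I, coeffVector ℂ n d (γ u) =
      b₀ + Pi.single (regPowIndex n d i) (Complex.exp (((2 * π * (u : ℝ) : ℝ) : ℂ) * Complex.I) * c))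
    -- the localisation datum on the member `X_c`
    {A B : Set ↥(pencilFibre n d i b₀ c)} (hAo : IsOpen A) (hBo : IsOpen B) (hAB : A ∪ B = Set.univ)
    (κ : C(↥(pencilFibre n d i b₀ c), ↥(pencilFibre n d i b₀ c)))
    (hκ : ∀ y, ((κ y : ↥(pencilFibre n d i b₀ c)) : ComplexPoints (regularTotal ℂ n d)) = (k (1, ⟨y.1, y.2.1⟩)).1)
    (hκB : ∀ y ∈ B, κ y = y)
    (κA : C(↥A, ↥A)) (hκA : ∀ a, ((κA a : ↥A) : ↥(pencilFibre n d i b₀ c)) = κ a.1)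
    (e : C(↥A, ↥(PhamBrieskorn.fibre (fun _ : Fin (n + 1) => (2 : ℕ)))))
    (hinj : Function.Injective (singularHomology.map ℚ ℚ e n).hom)
    (g : C(↥(PhamBrieskorn.fibre (fun _ : Fin (n + 1) => (2 : ℕ))), ↥(PhamBrieskorn.fibre (fun _ : Fin (n + 1) => (2 : ℕ)))))
    (hg : ∀ z, ((g z : ↥(PhamBrieskorn.fibre (fun _ : Fin (n + 1) => (2 : ℕ)))) : Fin (n + 1) → ℂ) = -(z : Fin (n + 1) → ℂ))
    (hconj : (e.comp κA).Homotopic (g.comp e))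
    -- the even-dimensional rider
    (hT1 : Even n → ∀ T : bettiCohomology (fiberOver (family ℂ n d) s) n ≃ₗ[ℚ] bettiCohomology (fiberOver (family ℂ n d) s) n,
      IsRatTransport (family ℂ n d) n hU (loopClassUniv n d γ) T → T ≠ LinearEquiv.refl ℚ _) :
    ∃ (δ : bettiCohomology (fiberOver (family ℂ n d) s) n) (c' : ℚ), IsPicardLefschetzData n d 1 hn hd hU γ ![δ] c' := by
  classical
  obtain ⟨m, rfl⟩ : ∃ m, n = m + 1 := ⟨n - 1, by omega⟩
  haveI : T2Space (ComplexPoints (regularTotal ℂ (m + 1) d)) := t2Space_regularTotal (m + 1) d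
  set Zs : Set (ℙ ℂ (Fin (m + 1 + 2) → ℂ)) := Projectivization.projZeroLocus {pointForm ℂ (m + 1) d s} with hZs
  let rot : ℝ → ℂ := fun u => Complex.exp (((2 * π * u : ℝ) : ℂ) * Complex.I)
  have hrot_neg : ∀ u : ℝ, Complex.exp (((-(2 * π * u) : ℝ) : ℂ) * Complex.I) * rot u = 1 := fun u => by
    simp only [rot]
    rw [← Complex.exp_add]
    push_cast
    rw [show -(2 * (π : ℂ) * u) * Complex.I + 2 * π * u * Complex.I = 0 by ring, Complex.exp_zero]
  have hrot1 : rot 1 = 1 := by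
    simp only [rot, mul_one]
    rw [show ((2 * π : ℝ) : ℂ) * Complex.I = 2 * π * Complex.I by push_cast; ring]
    exact Complex.exp_two_pi_mul_I
  -- the sections `σ_t : Z_t → 𝒴°(ℂ)`
  choose sec hσz hσb hσQ hσy using fun t : ComplexPoints (base ℂ (m + 1) d) => exists_section_projZeroLocus (m + 1) d hd t
  -- slice points from zero-set points
  have hγu : ∀ u : I, ∀ ℓ : {ℓ // ℓ ∈ Projectivization.projZeroLocus {pointForm ℂ (m + 1) d (γ u)}},
      sec (γ u) ℓ ∈ pencilSlice (m + 1) d i b₀ ∧ pencilCoord (m + 1) d i b₀ (sec (γ u) ℓ) = rot u * c := fun u ℓ =>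
    mem_pencilSlice_and_pencilCoord_eq_of_regCoeff_eq i b₀ (hγ u) (hσb (γ u) ℓ)
  have hsl : ∀ ℓ : {ℓ // ℓ ∈ Zs}, sec s ℓ ∈ pencilSlice (m + 1) d i b₀ ∧ pencilCoord (m + 1) d i b₀ (sec s ℓ) = c := fun ℓ =>
    mem_pencilSlice_and_pencilCoord_eq_of_regCoeff_eq i b₀ hs (hσb s ℓ)
  have hrotc0 : ∀ u : ℝ, rot u * c ≠ 0 := fun u => mul_ne_zero (Complex.exp_ne_zero _) hc0
  have hrotcδ : ∀ u : ℝ, ‖rot u * c‖ < δ₀ := fun u => by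
    simp only [rot]; rw [norm_mul, Complex.norm_exp_ofReal_mul_I, one_mul]; exact hcδ
  -- the slice point of `ℓ ∈ Z_s` (with `c ≠ 0`) and of `ℓ ∈ Z_{γ u}`
  let xs : {ℓ // ℓ ∈ Zs} → pencilSlice (m + 1) d i b₀ := fun ℓ => ⟨sec s ℓ, (hsl ℓ).1⟩
  let xu : ∀ u : I, {ℓ // ℓ ∈ Projectivization.projZeroLocus {pointForm ℂ (m + 1) d (γ u)}} → pencilSlice (m + 1) d i b₀ :=
    fun u ℓ => ⟨sec (γ u) ℓ, (hγu u ℓ).1⟩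
  have hxs0 : ∀ ℓ, pencilCoord (m + 1) d i b₀ (xs ℓ).1 ≠ 0 := fun ℓ => by
    change pencilCoord (m + 1) d i b₀ (sec s ℓ) ≠ 0; rw [(hsl ℓ).2]; exact hc0
  have hxsδ : ∀ ℓ, ‖pencilCoord (m + 1) d i b₀ (xs ℓ).1‖ < δ₀ := fun ℓ => by
    change ‖pencilCoord (m + 1) d i b₀ (sec s ℓ)‖ < δ₀; rw [(hsl ℓ).2]; exact hcδ
  have hxu0 : ∀ u ℓ, pencilCoord (m + 1) d i b₀ (xu u ℓ).1 ≠ 0 := fun u ℓ => by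
    change pencilCoord (m + 1) d i b₀ (sec (γ u) ℓ) ≠ 0; rw [(hγu u ℓ).2]; exact hrotc0 u
  have hxuδ : ∀ u ℓ, ‖pencilCoord (m + 1) d i b₀ (xu u ℓ).1‖ < δ₀ := fun u ℓ => by
    change ‖pencilCoord (m + 1) d i b₀ (sec (γ u) ℓ)‖ < δ₀; rw [(hγu u ℓ).2]; exact hrotcδ u
  -- the projective isotopy
  let hP : I → ℙ ℂ (Fin (m + 1 + 2) → ℂ) → ℙ ℂ (Fin (m + 1 + 2) → ℂ) := fun u ℓ =>
    if hℓ : ℓ ∈ Zs then hypersurfacePoint (regularToProjectiveSpace ℂ (m + 1) d) (h (u, xs ⟨ℓ, hℓ⟩)).1 else ℓ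
  let kP : I → ℙ ℂ (Fin (m + 1 + 2) → ℂ) → ℙ ℂ (Fin (m + 1 + 2) → ℂ) := fun u ℓ =>
    if hℓ : ℓ ∈ Projectivization.projZeroLocus {pointForm ℂ (m + 1) d (γ u)} then
      hypersurfacePoint (regularToProjectiveSpace ℂ (m + 1) d) (k (u, xu u ⟨ℓ, hℓ⟩)).1 else ℓ
  have hhP : ∀ (u : I) (ℓ : {ℓ // ℓ ∈ Zs}),
      hP u ℓ.1 = hypersurfacePoint (regularToProjectiveSpace ℂ (m + 1) d) (h (u, xs ℓ)).1 := fun u ℓ => by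
    simp only [hP, dif_pos ℓ.2]
  have hkP : ∀ (u : I) (ℓ : {ℓ // ℓ ∈ Projectivization.projZeroLocus {pointForm ℂ (m + 1) d (γ u)}}),
      kP u ℓ.1 = hypersurfacePoint (regularToProjectiveSpace ℂ (m + 1) d) (k (u, xu u ℓ)).1 := fun u ℓ => by
    simp only [kP, dif_pos ℓ.2]
  -- the image of `h(u, ·)` lies over `γ u`, that of `k(u, ·)` over `s`
  have hhreg : ∀ (u : I) (ℓ : {ℓ // ℓ ∈ Zs}), regCoeff ℂ (m + 1) d (h (u, xs ℓ)).1 = coeffVector ℂ (m + 1) d (γ u) := by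
    intro u ℓ
    obtain ⟨hpc, -, -, -⟩ := hhk u (xs ℓ) (hxs0 ℓ) (hxsδ ℓ)
    refine regCoeff_eq_coeffVector_of_pencilCoord_eq i b₀ (hγ u) (h (u, xs ℓ)).2 ?_
    rw [hpc]
    change rot u * pencilCoord (m + 1) d i b₀ (sec s ℓ) = rot u * c
    rw [(hsl ℓ).2]
  have hkreg : ∀ (u : I) (ℓ : {ℓ // ℓ ∈ Projectivization.projZeroLocus {pointForm ℂ (m + 1) d (γ u)}}),
      regCoeff ℂ (m + 1) d (k (u, xu u ℓ)).1 = coeffVector ℂ (m + 1) d s := by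
    intro u ℓ
    obtain ⟨-, -, -, hpk⟩ := hhk u (xu u ℓ) (hxu0 u ℓ) (hxuδ u ℓ)
    refine regCoeff_eq_coeffVector_of_pencilCoord_eq i b₀ hs (k (u, xu u ℓ)).2 ?_
    rw [hpk]
    change Complex.exp (((-(2 * π * (u : ℝ)) : ℝ) : ℂ) * Complex.I) * pencilCoord (m + 1) d i b₀ (sec (γ u) ℓ) = c
    rw [(hγu u ℓ).2, ← mul_assoc, hrot_neg, one_mul]
  -- the six hypotheses
  have H1 : Continuous fun uy : I × {ℓ // ℓ ∈ Zs} => hP uy.1 uy.2.1 := by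
    have hxsc : Continuous fun ℓ : {ℓ // ℓ ∈ Zs} =>
        (⟨xs ℓ, hxs0 ℓ⟩ : {x : pencilSlice (m + 1) d i b₀ // pencilCoord (m + 1) d i b₀ x.1 ≠ 0}) :=
      (((sec s).continuous).subtype_mk _).subtype_mk _
    have hc : Continuous fun uy : I × {ℓ // ℓ ∈ Zs} =>
        hypersurfacePoint (regularToProjectiveSpace ℂ (m + 1) d) (h ((uy.1 : ℝ), xs uy.2)).1 :=
      (continuous_hypersurfacePoint _).comp (continuous_subtype_val.comp
        (hhc.comp ((continuous_subtype_val.comp continuous_fst).prodMk (hxsc.comp continuous_snd))))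
    refine hc.congr fun uy => ?_
    exact (hhP uy.1 uy.2).symm
  have H2 : ∀ ℓ ∈ Zs, hP 0 ℓ = ℓ := fun ℓ hℓ => by
    rw [hhP 0 ⟨ℓ, hℓ⟩]
    change hypersurfacePoint _ (h ((0 : ℝ), xs ⟨ℓ, hℓ⟩)).1 = ℓ
    rw [hh0 (xs ⟨ℓ, hℓ⟩) (hxs0 _)]
    exact hσz s ⟨ℓ, hℓ⟩
  have H3 : ∀ (u : I), ∀ ℓ ∈ Zs, hP u ℓ ∈ Projectivization.projZeroLocus {pointForm ℂ (m + 1) d (γ u)} := fun u ℓ hℓ => by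
    rw [hhP u ⟨ℓ, hℓ⟩]
    exact hypersurfacePoint_mem_projZeroLocus_of_regCoeff_eq (m + 1) d (hhreg u ⟨ℓ, hℓ⟩)
  have H4 : ∀ (u : I), ∀ ℓ ∈ Projectivization.projZeroLocus {pointForm ℂ (m + 1) d (γ u)}, kP u ℓ ∈ Zs := fun u ℓ hℓ => by
    rw [hkP u ⟨ℓ, hℓ⟩]
    exact hypersurfacePoint_mem_projZeroLocus_of_regCoeff_eq (m + 1) d (hkreg u ⟨ℓ, hℓ⟩)
  have H5 : ∀ (u : I), ∀ ℓ ∈ Zs, kP u (hP u ℓ) = ℓ := by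
    intro u ℓ hℓ
    have hmem := H3 u ℓ hℓ
    rw [hkP u ⟨hP u ℓ, hmem⟩]
    -- the slice point of `h_u ℓ` over `γ u` is `h(u, xs ℓ)`
    have hx' : xu u ⟨hP u ℓ, hmem⟩ = h (u, xs ⟨ℓ, hℓ⟩) := by
      apply Subtype.ext
      change sec (γ u) ⟨hP u ℓ, hmem⟩ = (h (u, xs ⟨ℓ, hℓ⟩)).1
      have key := hσQ (γ u) (h (u, xs ⟨ℓ, hℓ⟩)).1 (hhreg u ⟨ℓ, hℓ⟩)
      have harg : (⟨hP u ℓ, hmem⟩ : {ℓ // ℓ ∈ Projectivization.projZeroLocus {pointForm ℂ (m + 1) d (γ u)}}) =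
          ⟨hypersurfacePoint (regularToProjectiveSpace ℂ (m + 1) d) (h (u, xs ⟨ℓ, hℓ⟩)).1,
            hypersurfacePoint_mem_projZeroLocus_of_regCoeff_eq (m + 1) d (hhreg u ⟨ℓ, hℓ⟩)⟩ :=
        Subtype.ext (hhP u ⟨ℓ, hℓ⟩)
      rw [harg]; exact key
    rw [hx', (hhk u (xs ⟨ℓ, hℓ⟩) (hxs0 _) (hxsδ _)).2.1]
    exact hσz s ⟨ℓ, hℓ⟩
  have H6 : ∀ (u : I), ∀ ℓ ∈ Projectivization.projZeroLocus {pointForm ℂ (m + 1) d (γ u)}, hP u (kP u ℓ) = ℓ := by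
    intro u ℓ hℓ
    have hmem := H4 u ℓ hℓ
    rw [hhP u ⟨kP u ℓ, hmem⟩]
    have hx' : xs ⟨kP u ℓ, hmem⟩ = k (u, xu u ⟨ℓ, hℓ⟩) := by
      apply Subtype.ext
      change sec s ⟨kP u ℓ, hmem⟩ = (k (u, xu u ⟨ℓ, hℓ⟩)).1
      have key := hσQ s (k (u, xu u ⟨ℓ, hℓ⟩)).1 (hkreg u ⟨ℓ, hℓ⟩)
      have harg : (⟨kP u ℓ, hmem⟩ : {ℓ // ℓ ∈ Zs}) =
          ⟨hypersurfacePoint (regularToProjectiveSpace ℂ (m + 1) d) (k (u, xu u ⟨ℓ, hℓ⟩)).1,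
            hypersurfacePoint_mem_projZeroLocus_of_regCoeff_eq (m + 1) d (hkreg u ⟨ℓ, hℓ⟩)⟩ :=
        Subtype.ext (hkP u ⟨ℓ, hℓ⟩)
      rw [harg]; exact key
    rw [hx', (hhk u (xu u ⟨ℓ, hℓ⟩) (hxu0 _ _) (hxuδ _ _)).2.2.1]
    exact hσz (γ u) ⟨ℓ, hℓ⟩
  -- the homeomorphism `Z_s ≃ₜ X_c`
  obtain ⟨τ₀, hτ₀, hτ₀s⟩ := exists_homeomorph_projZeroLocus_setOf_regCoeff_eq (m + 1) d hn hd s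
  have hXeq := setOf_regCoeff_eq_eq_pencilFibre i b₀ hs
  let τ : {ℓ // ℓ ∈ Zs} ≃ₜ ↥(pencilFibre (m + 1) d i b₀ c) := τ₀.trans (Homeomorph.setCongr hXeq)
  have hτ : ∀ ℓ, hypersurfacePoint (regularToProjectiveSpace ℂ (m + 1) d) (τ ℓ).1 = ℓ.1 := fun ℓ => hτ₀ ℓ
  have hτs : ∀ y : ↥(pencilFibre (m + 1) d i b₀ c), (τ.symm y).1 = hypersurfacePoint (regularToProjectiveSpace ℂ (m + 1) d) y.1 := fun y =>
    hτ₀s ⟨y.1, by rw [hXeq]; exact y.2⟩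
  have hτxs : ∀ ℓ : {ℓ // ℓ ∈ Zs}, (τ ℓ).1 = (xs ℓ).1 := by
    intro ℓ
    change (τ ℓ).1 = sec s ℓ
    have hreg : regCoeff ℂ (m + 1) d (τ ℓ).1 = coeffVector ℂ (m + 1) d s := by
      rw [hs]; exact (mem_pencilFibre_iff_regCoeff_eq b₀ c _).mp (τ ℓ).2
    have key := hσQ s (τ ℓ).1 hreg
    have harg : (⟨hypersurfacePoint (regularToProjectiveSpace ℂ (m + 1) d) (τ ℓ).1,
        hypersurfacePoint_mem_projZeroLocus_of_regCoeff_eq (m + 1) d hreg⟩ : {ℓ // ℓ ∈ Zs}) = ℓ := Subtype.ext (hτ ℓ)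
    rw [harg] at key
    exact key.symm
  -- the localisation datum on `Z_s`
  let κZ : C({ℓ // ℓ ∈ Zs}, {ℓ // ℓ ∈ Zs}) := ((τ.symm : C(↥(pencilFibre (m + 1) d i b₀ c), {ℓ // ℓ ∈ Zs})).comp κ).comp (τ : C({ℓ // ℓ ∈ Zs}, ↥(pencilFibre (m + 1) d i b₀ c)))
  have hκZ : ∀ ℓ : {ℓ // ℓ ∈ Zs}, (κZ ℓ).1 = kP 1 ℓ.1 := by
    intro ℓ
    change (τ.symm (κ (τ ℓ))).1 = kP 1 ℓ.1
    rw [hτs, hκ]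
    have hmem1 : ℓ.1 ∈ Projectivization.projZeroLocus {pointForm ℂ (m + 1) d (γ 1)} := by rw [γ.target]; exact ℓ.2
    rw [hkP 1 ⟨ℓ.1, hmem1⟩]
    -- `xu 1 ℓ = ⟨(τ ℓ).1, _⟩` as slice points
    have hx : xu 1 ⟨ℓ.1, hmem1⟩ = ⟨(τ ℓ).1, (τ ℓ).2.1⟩ := by
      apply Subtype.ext
      change sec (γ 1) ⟨ℓ.1, hmem1⟩ = (τ ℓ).1
      have hreg : regCoeff ℂ (m + 1) d (τ ℓ).1 = coeffVector ℂ (m + 1) d (γ 1) := by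
        rw [γ.target]
        exact regCoeff_eq_coeffVector_of_pencilCoord_eq i b₀ hs (τ ℓ).2.1 (τ ℓ).2.2
      have key := hσQ (γ 1) (τ ℓ).1 hreg
      have harg : (⟨hypersurfacePoint (regularToProjectiveSpace ℂ (m + 1) d) (τ ℓ).1,
          hypersurfacePoint_mem_projZeroLocus_of_regCoeff_eq (m + 1) d hreg⟩ :
            {ℓ // ℓ ∈ Projectivization.projZeroLocus {pointForm ℂ (m + 1) d (γ 1)}}) = ⟨ℓ.1, hmem1⟩ :=
        Subtype.ext (hτ ℓ)
      rw [harg] at key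
      exact key
    rw [hx, Set.Icc.coe_one]
  let AZ : Set {ℓ // ℓ ∈ Zs} := τ ⁻¹' A
  let BZ : Set {ℓ // ℓ ∈ Zs} := τ ⁻¹' B
  have hAZo : IsOpen AZ := hAo.preimage τ.continuous
  have hBZo : IsOpen BZ := hBo.preimage τ.continuous
  have hAZBZ : AZ ∪ BZ = Set.univ := by
    ext ℓ
    simp only [AZ, BZ, Set.mem_union, Set.mem_preimage, Set.mem_univ, iff_true]
    have : τ ℓ ∈ A ∪ B := by rw [hAB]; exact Set.mem_univ _
    exact this
  have hkB : ∀ z ∈ BZ, kP 1 z.1 = z.1 := by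
    intro z hz
    rw [← hκZ z]
    change (τ.symm (κ (τ z))).1 = z.1
    rw [hκB _ hz, Homeomorph.symm_apply_apply]
  -- the restriction of `κZ` to `AZ`
  have hmapsA : ∀ a : ↥AZ, κZ a.1 ∈ AZ := by
    intro a
    change τ (τ.symm (κ (τ a.1))) ∈ A
    rw [Homeomorph.apply_symm_apply, ← hκA ⟨τ a.1, a.2⟩]
    exact (κA ⟨τ a.1, a.2⟩).2
  let κAZ : C(↥AZ, ↥AZ) := ⟨fun a => ⟨κZ a.1, hmapsA a⟩, (κZ.continuous.comp continuous_subtype_val).subtype_mk _⟩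
  have hκAZ : ∀ a : ↥AZ, ((κAZ a : ↥AZ) : {ℓ // ℓ ∈ Zs}) = κZ a.1 := fun _ => rfl
  -- the chart on `AZ`
  let r : ↥AZ ≃ₜ ↥A := τ.sets rfl
  have hr : ∀ a : ↥AZ, ((r a : ↥A) : ↥(pencilFibre (m + 1) d i b₀ c)) = τ a.1 := fun _ => rfl
  let eZ : C(↥AZ, ↥(PhamBrieskorn.fibre (fun _ : Fin (m + 2) => (2 : ℕ)))) := e.comp (r : C(↥AZ, ↥A))
  have hinjZ : Function.Injective (singularHomology.map ℚ ℚ eZ (m + 1)).hom := by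
    have hcomp : singularHomology.map ℚ ℚ eZ (m + 1) =
        singularHomology.map ℚ ℚ (r : C(↥AZ, ↥A)) (m + 1) ≫ singularHomology.map ℚ ℚ e (m + 1) := by
      change singularHomology.map ℚ ℚ (e.comp (r : C(↥AZ, ↥A))) (m + 1) = _
      rw [singularHomology.map_comp]
    rw [hcomp, ModuleCat.hom_comp, LinearMap.coe_comp]
    exact hinj.comp (singularHomology.mapIso ℚ ℚ r (m + 1)).toLinearEquiv.injective
  have hrconj : (r : C(↥AZ, ↥A)).comp κAZ = κA.comp (r : C(↥AZ, ↥A)) := by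
    refine ContinuousMap.ext fun a => Subtype.ext ?_
    change τ (τ.symm (κ (τ a.1))) = ((κA (r a) : ↥A) : ↥(pencilFibre (m + 1) d i b₀ c))
    rw [Homeomorph.apply_symm_apply, hκA, hr]
  have hconjZ : (eZ.comp κAZ).Homotopic (g.comp eZ) := by
    have h1 : eZ.comp κAZ = (e.comp κA).comp (r : C(↥AZ, ↥A)) := by
      change (e.comp (r : C(↥AZ, ↥A))).comp κAZ = _
      rw [ContinuousMap.comp_assoc, hrconj, ← ContinuousMap.comp_assoc]
    have h2 : g.comp eZ = (g.comp e).comp (r : C(↥AZ, ↥A)) := by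
      change g.comp (e.comp (r : C(↥AZ, ↥A))) = _
      rw [← ContinuousMap.comp_assoc]
    rw [h1, h2]
    exact hconj.comp (ContinuousMap.Homotopic.refl _)
  -- the even-dimensional non-triviality, read on `Z_s`
  have hnt : Odd (m + 1) ∨ ∃ v, (singularCohomology.map ℚ ℚ κZ (m + 1)).hom v ≠ v := by
    rcases Nat.even_or_odd (m + 1) with heven | hodd
    · right
      obtain ⟨η, hη, hηs, hT, hTv⟩ := exists_homeomorph_isRatTransport_of_isotopy hn hd hU γ hP kP H1 H2 H3 H4 H5 H6
      have hne := hT1 heven _ (hT (m + 1))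
      -- `κZ ∘ es = es ∘ η⁻¹` for the zero-set model `es` of `Y_s(ℂ)`
      obtain ⟨es, hes⟩ := exists_homeomorph_fibrePoint (n := m + 1) hd s
      have hrel : ∀ y, es (η.symm y) = κZ (es y) := fun y =>
        Subtype.ext (by rw [hes, hηs, hκZ, hes])
      let Y := ComplexPoints (fiberOver (family ℂ (m + 1) d) s)
      let esC : C(Y, {ℓ // ℓ ∈ Zs}) := es
      let ηC : C(Y, Y) := η.symm
      have hce : κZ.comp esC = esC.comp ηC :=
        ContinuousMap.ext fun y => by
          change κZ (es y) = es (η.symm y)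
          exact (hrel y).symm
      have hmaps : singularCohomology.map ℚ ℚ κZ (m + 1) ≫ singularCohomology.map ℚ ℚ esC (m + 1) =
          singularCohomology.map ℚ ℚ esC (m + 1) ≫ singularCohomology.map ℚ ℚ ηC (m + 1) := by
        rw [← singularCohomology.map_comp, ← singularCohomology.map_comp, hce]
      by_contra hall
      push Not at hall
      apply hne
      refine LinearEquiv.ext fun w => ?_
      rw [LinearEquiv.refl_apply, hTv (m + 1) w]
      -- `w = es^* v` for some `v`
      obtain ⟨v, rfl⟩ := (singularCohomology.mapIso ℚ ℚ es (m + 1)).toLinearEquiv.surjective w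
      have key := congrArg (fun φ => φ.hom v) hmaps
      simp only [ModuleCat.hom_comp, LinearMap.coe_comp, Function.comp_apply, hall] at key
      exact key.symm
    · exact Or.inl hodd
  exact exists_isPicardLefschetzData_one_of_pencilIsotopy hd hU γ hP kP H1 H2 H3 H4 H5 H6 hAZo hBZo hAZBZ hkB κZ hκZ κAZ hκAZ
    eZ hinjZ g hg hconjZ hnt

end NodalPencil

end Literature.AlgebraicGeometry.HodgeTheory

end
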